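import Summits.AtomisticToContinuum.Crystallization.Theorems.FrustratedLawDichotomyStrainedPatchHomSplit
import Mathlib.Analysis.Calculus.Deriv.MeanValue

/-!
# The CONVEX-WELL bound: a uniformly convex function on a segment is above its tangent parabola (soundness core of the ξ-elimination leaf)

decomp-a2c hand-1 g26 (crux `AperiodicFrustratedLawGap`, stmt-AtomisticToContinuum-27623; `(H) HomFloor (1/625)`, hcp half; lever (C) of critic
rows 1011 / 1019, memo `HOME/decomp-a2c-hand-1/g26/C2-MEMO-hand-1-g26.md` §4).  For fixed entries `U` the shuffle enters the hcp box sum only through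
`F_U(ξ) = Σ_b W‖U(Hb + s + ξ)‖`, whose ξ-Hessian is `≥ λ > 0` on a ball around the relaxed shuffle (measured `λ = (8.05, 8.05, 39.2)` at hcp⋆,
`≥ 2.8` on radius `0.05` for strains `≤ 2.5 %`).  A leaf that certifies (i) a value bound `V ≤ E(ξ₀)`, (ii) a slope bound `|∂_v E(ξ₀)| ≤ G‖v‖` and
(iii) uniform convexity `λ` along every segment from `ξ₀` inside the ball, certifies `E(ξ) ≥ V − G²/(2λ)` for EVERY `ξ` of the ball at once —
the energy disjunct of the `(H)` dichotomy becomes a 6-dimensional problem in `U` (this file: the real-analysis core, stated for any real normed space).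

* §1 `tangentParabola_le` — 1-D: `g′(t) ≥ g′(0) + κ t` on `[0,1]` ⟹ `g 1 ≥ g 0 + g′ 0 + κ/2`;
* §2 `le_of_uniformlyConvex_segment` — along `t ↦ x₀ + t•v`: `f (x₀ + v) ≥ f x₀ + g′(0) + (λ/2)‖v‖²`;
  ★ `sub_le_of_uniformlyConvex_segment` — with `|g′(0)| ≤ G‖v‖`, `0 < λ`: `f (x₀ + v) ≥ f x₀ − G²/(2λ)` (complete the square).

NO definitions; 0 sorry; standard axioms; no instances / notation / `#eval`.  `--supports stmt-AtomisticToContinuum-27623`.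
-/

noncomputable section

namespace Summit.AtomisticToContinuum.Crystallization.Theorems.FrustratedLawDichotomyStrainedPatchHomConvexWell

/-! ## §1. One variable: above the tangent parabola -/

/-- ★ **TANGENT PARABOLA** (1-D).  If `g` has derivative `g′` on `[0,1]` and `g′ t ≥ g′ 0 + κ·t` there (the slope grows at rate `≥ κ`), then
`g 1 ≥ g 0 + g′ 0 + κ/2`. [folklore: `h(t) = g t − g 0 − g′(0) t − κ t²/2` has `h′ ≥ 0`] -/
theorem tangentParabola_le {g g' : ℝ → ℝ} {κ : ℝ} (hg : ∀ t ∈ Set.Icc (0 : ℝ) 1, HasDerivAt g (g' t) t)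
    (hmono : ∀ t ∈ Set.Icc (0 : ℝ) 1, g' 0 + κ * t ≤ g' t) : g 0 + g' 0 + κ / 2 ≤ g 1 := by
  set h : ℝ → ℝ := fun t => g t - g 0 - g' 0 * t - κ * t ^ 2 / 2 with hh
  have hder : ∀ t ∈ Set.Icc (0 : ℝ) 1, HasDerivAt h (g' t - g' 0 - κ * t) t := by
    intro t ht
    have h1 := hg t ht
    have h2 : HasDerivAt (fun u : ℝ => g' 0 * u) (g' 0 * 1) t := (hasDerivAt_id t).const_mul (g' 0)
    have h3 : HasDerivAt (fun u : ℝ => κ * u ^ 2 / 2) (κ * ((2 : ℕ) * t ^ (2 - 1) * 1) / 2) t :=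
      (((hasDerivAt_id t).pow 2).const_mul κ).div_const 2
    have h4 := ((h1.sub_const (g 0)).sub h2).sub h3
    refine h4.congr_deriv ?_
    push_cast
    ring
  have hcont : ContinuousOn h (Set.Icc 0 1) := fun t ht => (hder t ht).continuousAt.continuousWithinAt
  have hint : interior (Set.Icc (0 : ℝ) 1) = Set.Ioo 0 1 := interior_Icc
  have hdiff : DifferentiableOn ℝ h (interior (Set.Icc 0 1)) := by
    rw [hint]; exact fun t ht => (hder t (Set.Ioo_subset_Icc_self ht)).differentiableAt.differentiableWithinAt
  have hpos : ∀ t ∈ interior (Set.Icc (0 : ℝ) 1), 0 ≤ deriv h t := by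
    rw [hint]
    intro t ht
    rw [(hder t (Set.Ioo_subset_Icc_self ht)).deriv]
    linarith [hmono t (Set.Ioo_subset_Icc_self ht)]
  have hmvt := (convex_Icc (0 : ℝ) 1).mul_sub_le_image_sub_of_le_deriv hcont hdiff hpos 0 (Set.left_mem_Icc.2 zero_le_one) 1
    (Set.right_mem_Icc.2 zero_le_one) zero_le_one
  have h0 : h 0 = 0 := by simp [hh]
  have h1 : h 1 = g 1 - g 0 - g' 0 - κ / 2 := by simp only [hh]; ring
  rw [h0, h1] at hmvt
  linarith

/-! ## §2. Along a segment in a normed space -/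

variable {E : Type*} [NormedAddCommGroup E] [NormedSpace ℝ E]

/-- ★ **UNIFORM CONVEXITY ALONG A SEGMENT ⟹ above the tangent parabola.**  With `g t := f (x₀ + t • v)` differentiable on `[0,1]` with derivative
`g′` and `g′ t ≥ g′ 0 + λ‖v‖²·t` (the slope along the segment grows at rate `≥ λ‖v‖²`, e.g. Hessian `≥ λ`): `f (x₀ + v) ≥ f x₀ + g′ 0 + (λ/2)‖v‖²`.
[folklore] -/
theorem le_of_uniformlyConvex_segment {f : E → ℝ} {x₀ v : E} {g' : ℝ → ℝ} {lam : ℝ}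
    (hg : ∀ t ∈ Set.Icc (0 : ℝ) 1, HasDerivAt (fun t : ℝ => f (x₀ + t • v)) (g' t) t)
    (hmono : ∀ t ∈ Set.Icc (0 : ℝ) 1, g' 0 + lam * ‖v‖ ^ 2 * t ≤ g' t) :
    f x₀ + g' 0 + lam / 2 * ‖v‖ ^ 2 ≤ f (x₀ + v) := by
  have h := tangentParabola_le (g := fun t : ℝ => f (x₀ + t • v)) (κ := lam * ‖v‖ ^ 2) hg hmono
  simp only [zero_smul, add_zero, one_smul] at h
  linarith

/-- ★★ **THE CONVEX-WELL BOUND** (complete the square): under the hypotheses of `le_of_uniformlyConvex_segment` with `0 < λ` and a slope bound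
`|g′ 0| ≤ G‖v‖` at the centre, `f (x₀ + v) ≥ f x₀ − G²/(2λ)` — independently of `v`.  (A leaf certifying `V ≤ f x₀`, `G`, `λ` over a `U`-box and a
`ξ`-ball certifies the energy floor `V − G²/(2λ)` on the whole ball.) [folklore] -/
theorem sub_le_of_uniformlyConvex_segment {f : E → ℝ} {x₀ v : E} {g' : ℝ → ℝ} {lam G : ℝ} (hlam : 0 < lam)
    (hg : ∀ t ∈ Set.Icc (0 : ℝ) 1, HasDerivAt (fun t : ℝ => f (x₀ + t • v)) (g' t) t)
    (hmono : ∀ t ∈ Set.Icc (0 : ℝ) 1, g' 0 + lam * ‖v‖ ^ 2 * t ≤ g' t) (hG : |g' 0| ≤ G * ‖v‖) :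
    f x₀ - G ^ 2 / (2 * lam) ≤ f (x₀ + v) := by
  have h := le_of_uniformlyConvex_segment hg hmono
  have hsq : -(G ^ 2 / (2 * lam)) ≤ g' 0 + lam / 2 * ‖v‖ ^ 2 := by
    -- `λ/2·r² − G r ≥ −G²/(2λ)` with `r = ‖v‖`, and `g′ 0 ≥ −G r`
    have hr : -(G * ‖v‖) ≤ g' 0 := (abs_le.1 hG).1
    have key : 0 ≤ lam / 2 * ‖v‖ ^ 2 - G * ‖v‖ + G ^ 2 / (2 * lam) := by
      have : lam / 2 * ‖v‖ ^ 2 - G * ‖v‖ + G ^ 2 / (2 * lam) = (lam * ‖v‖ - G) ^ 2 / (2 * lam) := by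
        field_simp
        ring
      rw [this]; positivity
    linarith
  linarith

/-- ★ **Value form for the certificate**: certified data `V ≤ f x₀` (value), `G` (slope), `λ > 0` (uniform convexity along the segment) give
`V − G²/(2λ) ≤ f (x₀ + v)`. [formal bookkeeping] -/
theorem floor_of_uniformlyConvex_segment {f : E → ℝ} {x₀ v : E} {g' : ℝ → ℝ} {lam G V : ℝ} (hlam : 0 < lam) (hV : V ≤ f x₀)
    (hg : ∀ t ∈ Set.Icc (0 : ℝ) 1, HasDerivAt (fun t : ℝ => f (x₀ + t • v)) (g' t) t)
    (hmono : ∀ t ∈ Set.Icc (0 : ℝ) 1, g' 0 + lam * ‖v‖ ^ 2 * t ≤ g' t) (hG : |g' 0| ≤ G * ‖v‖) :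
    V - G ^ 2 / (2 * lam) ≤ f (x₀ + v) :=
  (sub_le_sub_right hV _).trans (sub_le_of_uniformlyConvex_segment hlam hg hmono hG)

end Summit.AtomisticToContinuum.Crystallization.Theorems.FrustratedLawDichotomyStrainedPatchHomConvexWell
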